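import Summits.AnomalousDissipation.AnomalousDissipation.Theorems.TwodBoundedEnergyZeroMomentum.Negative.FirstShellGalerkin
import Literature.Analysis.FluidPDE.LerayHopfTimeSliceTorus

/-!
# General first-shell forces, II: every solution inherits the decay; the trilinear pairing is small
(negative-side support for the crux `TwoAndHalfD.TwodBoundedEnergyZeroMomentum`,
stmt-AnomalousDissipation-10786; cdisprove seat `refuter-cdisprove-stmt-AnomalousDissipation-10786-g2-0`)

Second of three files (`FirstShellGalerkin` → `FirstShellTrilinear` → `FirstShellGeneral`).

* `bound_and_enstrophyExcess_tendsto_zero_of_firstShell` — by 2-D uniqueness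
  (`lions_prodi_uniqueness_torus2_holds`) EVERY zero-momentum global Leray–Hopf solution under a
  first-shell force is bounded in `L²` and has enstrophy excess `→ 0` (energies and Fourier
  coefficients only see the a.e. class of a slice); `tendsto_integral_norm_sq_truncate_sub` —
  hence `∫ ‖P₁u(t) - u(t)‖² → 0` ((A.34)).
* `integral_inner_convect_truncate_firstShell_eq_zero` — the first-eigenspace part of the
  trilinear pairing `∫⟪P₁v, (P₁v·∇)g⟫` vanishes for a first-shell `g` (parity:
  `|l|² = |m|² = 1 ⇒ |l + m|² ≠ 1`, FMRT App. III.A.4 p. 180);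
  `abs_integral_inner_convect_firstShell_le(_sqrt)` — so `|∫⟪v,(v·∇)g⟫| ≤ 2D√K ‖P₁v - v‖₂`
  along an `L²`-bounded field with no mean mode.

## References

* C. Foias, O. Manley, R. Rosa, R. Temam, *Navier–Stokes Equations and Turbulence*, CUP 2001,
  Ch. II Thm. 7.3; App. III.A.4 (A.34) and pp. 179–180.
-/

noncomputable section

open MeasureTheory Set Filter Topology UnitAddTorus
open scoped ENNReal NNReal InnerProductSpace ComplexConjugate

namespace Summit.AnomalousDissipation.AnomalousDissipation.Theorems.TwodBoundedEnergyZeroMomentum.Negative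

open Literature.Analysis.FunctionSpaces Literature.Analysis.FunctionSpaces.Torus
open Literature.Analysis.FluidPDE Literature.Analysis.FluidPDE.Torus
open Literature.Barriers.AnomalousDissipation


/-! ### Every Leray–Hopf solution: `L²` bound and decay of the excess (2-D uniqueness) -/

section Transfer

variable {ν : ℝ} {g u₀ : (UnitAddTorus (Fin 2)) → (EuclideanSpace ℝ (Fin 2))} {u : ℝ → (UnitAddTorus (Fin 2)) → (EuclideanSpace ℝ (Fin 2))}

/-- **Every zero-momentum Leray–Hopf solution under a first-shell force is bounded in `L²` and
has vanishing enstrophy excess** (the Galerkin solution of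
`exists_lerayHopf_enstrophyExcess_tendsto_zero_of_firstShell` is the only one, by 2-D
uniqueness `lions_prodi_uniqueness_torus2_holds`; energies and Fourier coefficients only see the
a.e. class of a slice). [folklore] -/
theorem bound_and_enstrophyExcess_tendsto_zero_of_firstShell (hν : 0 < ν) (hg : IsSmooth g)
    (hgm : HasZeroMean g)
    (hg1 : ∀ k : (Fin 2 → ℤ), freqNormSq k ≠ 1 → mFourierCoeff (EuclideanSpace.complexify ∘ g) k = 0)
    (hu₀ : MemLp u₀ 2 volume) (h0 : HasZeroMean u₀)
    (hu : IsGlobalLerayHopf ν (fun _ => g) u₀ u) :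
    (∃ K : ℝ, 0 ≤ K ∧ ∀ t, 0 < t → ∫ x, ‖u t x‖ ^ 2 ≤ K) ∧
      Tendsto (fun t => enstrophyExcess (u t)) atTop (𝓝 0) := by
  obtain ⟨w, hw, ⟨K, hK⟩, hE⟩ := exists_lerayHopf_enstrophyExcess_tendsto_zero_of_firstShell hg hgm
    hg1 hν hu₀ hu.isWeaklyDivFree_datum h0
  have hfm : AEStronglyMeasurable (stLift fun _ : ℝ => g) (volume.restrict (Ioi 0 ×ˢ univ)) :=
    aestronglyMeasurable_stLift_steady hg.continuous _
  have hf₂ : ∀ T : ℝ, 0 < T → ∫⁻ _ in Ioo 0 T, ∫⁻ x, ‖g x‖ₑ ^ 2 < ⊤ := fun T _ =>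
    lintegral_Ioo_lintegral_enorm_sq_steady_lt_top (hg.memLp 2) T
  have hae : ∀ t, 0 < t → u t =ᵐ[volume] w t := fun t ht =>
    lions_prodi_uniqueness_torus2_holds.global hν hfm hf₂ hu₀ hu.isWeaklyDivFree_datum hu hw ht
  have hK0 : 0 ≤ K := (integral_nonneg fun x => sq_nonneg _).trans (hK 0 le_rfl)
  refine ⟨⟨K, hK0, fun t ht => ?_⟩, ?_⟩
  · have h : (fun x => ‖u t x‖ ^ 2) =ᵐ[volume] fun x => ‖w t x‖ ^ 2 := by
      filter_upwards [hae t ht] with x hx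
      rw [hx]
    rw [integral_congr_ae h]
    exact hK t ht.le
  · refine hE.congr' ?_
    filter_upwards [eventually_gt_atTop 0] with t ht
    rw [enstrophyExcess_def, enstrophyExcess_def]
    refine tsum_congr fun k => ?_
    rw [mFourierCoeff_congr_ae ((hae t ht).fun_comp EuclideanSpace.complexify) k]

/-- **(A.34) along every solution**: `∫ ‖P₁u(t) - u(t)‖² → 0` whenever the enstrophy excess of
the slices tends to zero (FMRT 2001, App. III.A.4 (A.34); the tree's
`tendsto_integral_norm_sq_fourierTruncate_sub` for a general force). [cite: FoiasManleyRosaTemam2001, App. III.A.4 (A.34)] -/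
theorem tendsto_integral_norm_sq_truncate_sub {f : ℝ → (UnitAddTorus (Fin 2)) → (EuclideanSpace ℝ (Fin 2))}
    (hu : IsGlobalLerayHopf ν f u₀ u)
    (hE : Tendsto (fun t => enstrophyExcess (u t)) atTop (𝓝 0)) :
    Tendsto (fun t => ∫ x, ‖fourierTruncate 1 (u t) x - u t x‖ ^ 2) atTop (𝓝 0) := by
  have h1 : Tendsto (fun t => ENNReal.ofReal (∫ x, ‖fourierTruncate 1 (u t) x - u t x‖ ^ 2))
      atTop (𝓝 0) := by
    refine tendsto_of_tendsto_of_tendsto_of_le_of_le' tendsto_const_nhds hE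
      (Eventually.of_forall fun t => bot_le) ?_
    filter_upwards [eventually_gt_atTop 0] with t ht
    have hut : MemLp (u t) 2 volume := hu.memLp_two ht.le
    have h := Torus.lintegral_enorm_sq_eq_ofReal ((memLp_fourierTruncate 1 (u t) 2).sub hut)
    simp only [Pi.sub_apply] at h
    rw [← h]
    exact lintegral_enorm_sq_fourierTruncate_sub_le_enstrophyExcess hut
  have h2 := (ENNReal.tendsto_toReal ENNReal.zero_ne_top).comp h1
  rw [ENNReal.toReal_zero] at h2
  refine h2.congr' (Eventually.of_forall fun t => ?_)
  exact ENNReal.toReal_ofReal (integral_nonneg fun x => sq_nonneg _)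

end Transfer

/-! ### The trilinear pairing against a first-shell force is small with the tail `|Q₁u|` -/

section Trilinear

variable {g : (UnitAddTorus (Fin 2)) → (EuclideanSpace ℝ (Fin 2))}

/-- **The first-eigenspace part of the trilinear pairing vanishes**: for an integrable `v` with no
mean mode and a first-shell force `g`, `∫ ⟪P₁v, (P₁v·∇)g⟫ = 0` — all three entries lie in the
first eigenspace (FMRT 2001, App. III.A.4, p. 180; `integral_inner_convect_freqBall_one_eq_zero`). [cite: FoiasManleyRosaTemam2001, App. III.A.4 (p. 180)] -/
theorem integral_inner_convect_truncate_firstShell_eq_zero {v : (UnitAddTorus (Fin 2)) → (EuclideanSpace ℝ (Fin 2))}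
    (hv : Integrable v volume) (hv0 : mFourierCoeff (EuclideanSpace.complexify ∘ v) 0 = 0)
    (hgc : Continuous g)
    (hg1 : ∀ k : (Fin 2 → ℤ), freqNormSq k ≠ 1 → mFourierCoeff (EuclideanSpace.complexify ∘ g) k = 0) :
    ∫ x, ⟪fourierTruncate 1 v x, convect (fourierTruncate 1 v) g x⟫_ℝ = 0 := by
  set c : (Fin 2 → ℤ) → (EuclideanSpace ℂ (Fin 2)) := fun k => mFourierCoeff (EuclideanSpace.complexify ∘ g) k with hc
  have hg' : g = realTrigPoly (freqBall 1) c := eq_realTrigPoly_of_firstShell hgc hg1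
  have hgi : Integrable g volume := hgc.integrable_unitAddTorus
  rw [hg', fourierTruncate_eq]
  exact integral_inner_convect_freqBall_one_eq_zero (isConjSymm_mFourierCoeff hv)
    (isConjSymm_mFourierCoeff hgi) hv0 (mFourierCoeff_zero_of_firstShell hg1)

/-- **The trilinear pairing with a `Q₁` entry** (FMRT 2001, App. III.A.4, p. 179: "all the
trilinear terms with `Q₄v` in one of the entries"): for `v ∈ L²((UnitAddTorus (Fin 2)))` with no mean mode and a
first-shell force `g` with `∑ᵢ ‖∂ᵢ g‖ ≤ D` pointwise,
`|∫ ⟪v, (v·∇)g⟫| ≤ D ∫ ‖P₁v - v‖ (‖v‖ + ‖P₁v‖)`. [cite: FoiasManleyRosaTemam2001, App. III.A.4 (pp. 179–180)] -/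
theorem abs_integral_inner_convect_firstShell_le {v : (UnitAddTorus (Fin 2)) → (EuclideanSpace ℝ (Fin 2))} (hv : MemLp v 2 volume)
    (hv0 : mFourierCoeff (EuclideanSpace.complexify ∘ v) 0 = 0) (hgc : Continuous g)
    (hg1 : ∀ k : (Fin 2 → ℤ), freqNormSq k ≠ 1 → mFourierCoeff (EuclideanSpace.complexify ∘ g) k = 0)
    {D : ℝ} (hD : ∀ x, ∑ i, ‖partialDeriv i g x‖ ≤ D) :
    |∫ x, ⟪v x, convect v g x⟫_ℝ| ≤
      D * ∫ x, ‖fourierTruncate 1 v x - v x‖ * (‖v x‖ + ‖fourierTruncate 1 v x‖) := by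
  set w := fourierTruncate 1 v with hw
  have hΨ : IsSmooth g := isSmooth_of_firstShell hgc hg1
  have hD0 : 0 ≤ D := (Finset.sum_nonneg fun i _ => norm_nonneg _).trans (hD 0)
  have hvi : Integrable v volume := hv.integrable one_le_two
  have hwm : MemLp w 2 volume := memLp_fourierTruncate 1 v 2
  have i1 : Integrable (fun x => ⟪v x, convect v g x⟫_ℝ) volume := integrable_inner_convect_self hv hΨ
  have i2 : Integrable (fun x => ⟪w x, convect w g x⟫_ℝ) volume := integrable_inner_convect_self hwm hΨ
  have h0 : ∫ x, ⟪w x, convect w g x⟫_ℝ = 0 :=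
    integral_inner_convect_truncate_firstShell_eq_zero hvi hv0 hgc hg1
  rw [← sub_zero (∫ x, ⟪v x, convect v g x⟫_ℝ), ← h0, ← integral_sub i1 i2]
  have hconv : ∀ (a : (UnitAddTorus (Fin 2)) → (EuclideanSpace ℝ (Fin 2))) (x : (UnitAddTorus (Fin 2))), ‖convect a g x‖ ≤ D * ‖a x‖ := fun a x => by
    have h := norm_convect_le a (hΨ.isContDiff (by simp)) x
    calc ‖convect a g x‖ ≤ ‖a x‖ * ∑ i, ‖partialDeriv i g x‖ := h
      _ ≤ ‖a x‖ * D := mul_le_mul_of_nonneg_left (hD x) (norm_nonneg _)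
      _ = D * ‖a x‖ := mul_comm _ _
  have hpt : ∀ x, ‖⟪v x, convect v g x⟫_ℝ - ⟪w x, convect w g x⟫_ℝ‖ ≤
      D * (‖w x - v x‖ * (‖v x‖ + ‖w x‖)) := by
    intro x
    have hsub : convect v g x - convect w g x = convect (v - w) g x := by
      simp only [Torus.convect, Pi.sub_apply, map_sub]
    have hid : ⟪v x, convect v g x⟫_ℝ - ⟪w x, convect w g x⟫_ℝ =
        ⟪v x - w x, convect v g x⟫_ℝ + ⟪w x, convect (v - w) g x⟫_ℝ := by
      rw [← hsub, inner_sub_left, inner_sub_right]; ring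
    rw [hid, Real.norm_eq_abs]
    refine (abs_add_le _ _).trans ?_
    have h1 := abs_real_inner_le_norm (v x - w x) (convect v g x)
    have h2 := abs_real_inner_le_norm (w x) (convect (v - w) g x)
    have h3 := hconv v x
    have h4 := hconv (v - w) x
    rw [Pi.sub_apply] at h4
    have h5 : ‖v x - w x‖ = ‖w x - v x‖ := norm_sub_rev _ _
    calc |⟪v x - w x, convect v g x⟫_ℝ| + |⟪w x, convect (v - w) g x⟫_ℝ|
        ≤ ‖v x - w x‖ * (D * ‖v x‖) + ‖w x‖ * (D * ‖v x - w x‖) :=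
          add_le_add (h1.trans (mul_le_mul_of_nonneg_left h3 (norm_nonneg _)))
            (h2.trans (mul_le_mul_of_nonneg_left h4 (norm_nonneg _)))
      _ = D * (‖w x - v x‖ * (‖v x‖ + ‖w x‖)) := by rw [h5]; ring
  have hint : Integrable (fun x => D * (‖w x - v x‖ * (‖v x‖ + ‖w x‖))) volume := by
    refine Integrable.const_mul ?_ _
    have hf : MemLp (fun x => ‖w x - v x‖) 2 volume := by
      have := (hwm.sub hv).norm
      simpa only [Pi.sub_apply] using this
    have hg : MemLp (fun x => ‖v x‖ + ‖w x‖) 2 volume := hv.norm.add hwm.norm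
    exact hf.integrable_mul hg
  calc |∫ x, (⟪v x, convect v g x⟫_ℝ - ⟪w x, convect w g x⟫_ℝ)|
        = ‖∫ x, (⟪v x, convect v g x⟫_ℝ - ⟪w x, convect w g x⟫_ℝ)‖ := (Real.norm_eq_abs _).symm
    _ ≤ ∫ x, D * (‖w x - v x‖ * (‖v x‖ + ‖w x‖)) :=
        norm_integral_le_of_norm_le hint (ae_of_all _ hpt)
    _ = D * ∫ x, ‖w x - v x‖ * (‖v x‖ + ‖w x‖) := integral_const_mul _ _

/-- **The trilinear pairing along a bounded solution decays with the tail**: for `v ∈ L²((UnitAddTorus (Fin 2)))`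
with no mean mode, `∫ ‖v‖² ≤ K`, and a first-shell force with `∑ᵢ ‖∂ᵢ g‖ ≤ D`,
`|∫ ⟪v, (v·∇)g⟫| ≤ 2 D √K (∫ ‖P₁v - v‖²)^{1/2}`. [folklore] -/
theorem abs_integral_inner_convect_firstShell_le_sqrt {v : (UnitAddTorus (Fin 2)) → (EuclideanSpace ℝ (Fin 2))} (hv : MemLp v 2 volume)
    (hv0 : mFourierCoeff (EuclideanSpace.complexify ∘ v) 0 = 0) (hgc : Continuous g)
    (hg1 : ∀ k : (Fin 2 → ℤ), freqNormSq k ≠ 1 → mFourierCoeff (EuclideanSpace.complexify ∘ g) k = 0)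
    {D : ℝ} (hD : ∀ x, ∑ i, ‖partialDeriv i g x‖ ≤ D) {K : ℝ} (hK : ∫ x, ‖v x‖ ^ 2 ≤ K) :
    |∫ x, ⟪v x, convect v g x⟫_ℝ| ≤
      2 * D * Real.sqrt K * Real.sqrt (∫ x, ‖fourierTruncate 1 v x - v x‖ ^ 2) := by
  set w := fourierTruncate 1 v with hw
  have hD0 : 0 ≤ D := (Finset.sum_nonneg fun i _ => norm_nonneg _).trans (hD 0)
  have hwm : MemLp w 2 volume := memLp_fourierTruncate 1 v 2
  have hqm : MemLp (fun x => w x - v x) 2 volume := hwm.sub hv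
  have h := abs_integral_inner_convect_firstShell_le hv hv0 hgc hg1 hD
  have hw2 : ∫ x, ‖w x‖ ^ 2 ≤ K := (integral_norm_sq_fourierTruncate_le hv 1).trans hK
  have iu : Integrable (fun x => ‖w x - v x‖ * ‖v x‖) volume := hqm.norm.integrable_mul hv.norm
  have iw : Integrable (fun x => ‖w x - v x‖ * ‖w x‖) volume := hqm.norm.integrable_mul hwm.norm
  have hsplit : ∫ x, ‖w x - v x‖ * (‖v x‖ + ‖w x‖) =
      (∫ x, ‖w x - v x‖ * ‖v x‖) + ∫ x, ‖w x - v x‖ * ‖w x‖ := by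
    rw [← integral_add iu iw]
    refine integral_congr_ae (ae_of_all _ fun x => ?_)
    ring
  have h1 : ∫ x, ‖w x - v x‖ * ‖v x‖ ≤ Real.sqrt (∫ x, ‖w x - v x‖ ^ 2) * Real.sqrt K := by
    refine le_trans ?_ (mul_le_mul_of_nonneg_left (Real.sqrt_le_sqrt hK) (Real.sqrt_nonneg _))
    have := integral_norm_mul_norm_le_sqrt hqm hv
    simpa only [norm_norm] using this
  have h2 : ∫ x, ‖w x - v x‖ * ‖w x‖ ≤ Real.sqrt (∫ x, ‖w x - v x‖ ^ 2) * Real.sqrt K := by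
    refine le_trans ?_ (mul_le_mul_of_nonneg_left (Real.sqrt_le_sqrt hw2) (Real.sqrt_nonneg _))
    have := integral_norm_mul_norm_le_sqrt hqm hwm
    simpa only [norm_norm] using this
  refine h.trans ?_
  rw [hsplit]
  calc D * ((∫ x, ‖w x - v x‖ * ‖v x‖) + ∫ x, ‖w x - v x‖ * ‖w x‖)
      ≤ D * (Real.sqrt (∫ x, ‖w x - v x‖ ^ 2) * Real.sqrt K +
          Real.sqrt (∫ x, ‖w x - v x‖ ^ 2) * Real.sqrt K) :=
        mul_le_mul_of_nonneg_left (add_le_add h1 h2) hD0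
    _ = 2 * D * Real.sqrt K * Real.sqrt (∫ x, ‖w x - v x‖ ^ 2) := by ring

end Trilinear

end Summit.AnomalousDissipation.AnomalousDissipation.Theorems.TwodBoundedEnergyZeroMomentum.Negative

end
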